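import Summits.QuantumFields.GaugeBoot.LinearShiftDerivatives
import HarnessLib

/-!
# Schwinger–Dyson rows with conjugation-invariant test functions vanish identically on conjugation-invariant states (gauge-boot, L1 supplement)

HONEST FRAMING (cell `pub-gaugeboot`, page 1 of every file): the venture produces certified bounds
on lattice expectations at stated coupling, gauge group, dimension and torus size; NOT a mass gap,
NOT a continuum limit, NOT a string tension; NOT Yang–Mills-summit-bearing (barriers
`FixedCouplingUltralocality`, `PerturbativeInvisibility`). Structural; it certifies no number.

## Content

A one-link Schwinger–Dyson row of the lattice bootstrap reads `∫ X·f dμ = β ∫ f · (X·S) dμ`, where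
`X·F (U) = d/dt F(U[e ↦ k(t) U_e])|_{t=0}` is the derivative along the left shift of the link `e` by a
one-parameter subgroup `ρ(k t) = e^{tX}` (`SchwingerDysonStates.IsSchwingerDysonState`, the cell's
`sd_pair`). This file proves that such a row is TRIVIAL (`0 = β · 0`) as soon as the test function
`f`, the action `S` and the state `μ` are invariant under GLOBAL conjugation `U ↦ (g U_i g⁻¹)_i`
and the generator `X` is traceless — for every compact group `G` seen through a faithful unitary
representation `ρ` with the Schur second moments `∫ ρ_{ai} conj ρ_{bk} = δ_{ab} δ_{ik} / N`
(`SU(N)`, `U(N)`: tree `integral_entry_mul_conj_entry`, `integral_entry_mul_conj_entry_unitary`):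

* (from `LinearShiftDerivatives.lean`) `HasLinearShiftDeriv r e S D` — the derivative of `S` along
  every exponential shift at `e` is a LINEAR functional `D U` of the generator (every polynomial
  observable has one), and ★ `HasLinearShiftDeriv.apply_conjAct` — for conjugation-invariant `S`,
  `D (g U g⁻¹) X = D U (ρ(g⁻¹) X ρ(g))`;
* `HasSchurMoments r` — the second-moment identity above; `integral_conj_apply` /
  ★ `integral_conj_eq_smul_one` — SCHUR AVERAGING `∫ ρ(g⁻¹) X ρ(g) dg = (tr X / N) · 1`;
  `LinearMap.eq_apply_integral_of_forall_eq` — an `ℝ`-linear functional constant along an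
  integrable family takes that value at the family's average;
* ★★ `integral_mul_linearShiftDeriv_eq_zero` — MAIN: `μ` finite and conjugation invariant, `f`
  continuous conjugation invariant, `S` conjugation invariant with a linear shift derivative `D`,
  `X` a traceless generator ⇒ `∫ f(U) · D U X dμ = 0`: the functional `Ψ(Y) = ∫ f · D(·) Y dμ` is
  `ℝ`-linear and `Ψ(ρ(g⁻¹) X ρ(g)) = Ψ(X)` (covariance + invariance of `μ`), so
  `Ψ(X) = Ψ((tr X / N) · 1) = 0`; ★★ `integral_mul_shiftDeriv_eq_zero` (any derivative `S'`),
  ★★ `integral_shiftDeriv_eq_zero` (`∫ X·f dμ = 0`), and ★★ `sdRow_of_conjInvariant` — BOTH SIDES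
  of the row vanish, so the row `∫ X·f dμ = β ∫ f · (X·S) dμ` holds at EVERY real `β`;
  ★★ `integral_mul_linearShiftDeriv_eq_central` (appendix) — without the trace condition the row
  sees only the central component `(tr X / N) · 1` of `X` (for `U(N)`: the `U(1)` direction).

THESE ROWS CARRY NO INFORMATION: a conjugation-invariant (a fortiori gauge-invariant) test function
contributes the row `0 = 0` in every conjugation-invariant state, whatever the coupling; the content
of the loop equations (Makeenko–Migdal) sits in the COVARIANT matrix-valued test functions
`(hol_w)_{ij}` before contraction — complementing `PolynomialSchwingerDyson.lean` (the rows over ALL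
polynomial test functions determine Wilson's measure). The sequel
`AdInvariantSchwingerDysonRowsUnitary.lean` instantiates `SU(N)` / `U(N)` on the torus: Wilson's
measure at ANY coupling `β'` satisfies every such row of the Wilson action at coupling `β`.

References: Yu. Makeenko, A. Migdal, Phys. Lett. B 88 (1979) 135; Yu. Makeenko, *Methods of
contemporary gauge theory* (2002) Ch. 12 (lattice loop equation from a matrix-valued shift);
M. Creutz, *Quarks, gluons and lattices* (1983) Ch. 8, 11; V. Kazakov, Z. Zheng, arXiv:2203.11360
§2. The vanishing statement is Schur averaging; folklore, not located in print.
-/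

noncomputable section

open MeasureTheory Filter Topology NormedSpace
open scoped Matrix.Norms.Frobenius Matrix
open Literature.MathematicalPhysics.QuantumFieldTheory (LatticeRep haarProbability)

namespace Summit.QuantumFields.GaugeBoot

variable {ι : Type*} [DecidableEq ι] {G : Type*} [Group G] [TopologicalSpace G] (r : LatticeRep G)

/-! ## Schur averaging -/

section Averaging

variable [IsTopologicalGroup G] [CompactSpace G] [MeasurableSpace G] [BorelSpace G]

/-- **Schur second moments** of the representation: `∫ ρ(g)_{ai} conj ρ(g)_{bk} dg = δ_{ab} δ_{ik}/N`
(Haar probability measure). Holds for `G ≅ SU(N)` and `G ≅ U(N)` in the defining representation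
(tree `integral_entry_mul_conj_entry`, `DiagRPSUN.integral_entry_mul_conj_entry_unitary`), and for
every irreducible unitary `ρ` (Schur orthogonality). [shape] A parametric definition of a
proposition — NOT a fact. [folklore] -/
def HasSchurMoments : Prop :=
  ∀ a i b k : Fin r.N, ∫ g, r.ρ g a i * (starRingEnd ℂ) (r.ρ g b k) ∂haarProbability G =
    if a = b ∧ i = k then ((r.N : ℂ))⁻¹ else 0

variable {r}

omit [DecidableEq ι] [IsTopologicalGroup G] [CompactSpace G] [MeasurableSpace G] [BorelSpace G] in
/-- Unitarity: `ρ(g⁻¹)_{ab} = conj ρ(g)_{ba}`. -/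
theorem rho_inv_apply (g : G) (a b : Fin r.N) : r.ρ g⁻¹ a b = (starRingEnd ℂ) (r.ρ g b a) := by
  have hu := r.mem_unitary g
  rw [Matrix.mem_unitaryGroup_iff] at hu
  have h1 : r.ρ g⁻¹ * r.ρ g = 1 := by rw [← map_mul, inv_mul_cancel, map_one]
  have h : r.ρ g⁻¹ = star (r.ρ g) :=
    calc r.ρ g⁻¹ = r.ρ g⁻¹ * (r.ρ g * star (r.ρ g)) := by rw [hu, mul_one]
      _ = star (r.ρ g) := by rw [← mul_assoc, h1, one_mul]
  rw [h, Matrix.star_apply, Complex.star_def]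

omit [DecidableEq ι] in
/-- **Schur averaging, entrywise**: `∫ (ρ(g⁻¹) X ρ(g))_{ab} dg = δ_{ab} tr X / N`. [folklore] -/
theorem integral_conj_apply (hr : HasSchurMoments r) (X : Matrix (Fin r.N) (Fin r.N) ℂ)
    (a b : Fin r.N) :
    ∫ g, (r.ρ g⁻¹ * X * r.ρ g) a b ∂haarProbability G =
      if a = b then ((r.N : ℂ))⁻¹ * X.trace else 0 := by
  have hexp : (fun g => (r.ρ g⁻¹ * X * r.ρ g) a b) =
      fun g => ∑ c, ∑ s, X s c * (r.ρ g c b * (starRingEnd ℂ) (r.ρ g s a)) := by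
    funext g
    rw [Matrix.mul_apply]
    refine Finset.sum_congr rfl fun c _ => ?_
    rw [Matrix.mul_apply, Finset.sum_mul]
    refine Finset.sum_congr rfl fun s _ => ?_
    rw [rho_inv_apply]
    ring
  have hI : ∀ c s, Integrable (fun g => X s c * (r.ρ g c b * (starRingEnd ℂ) (r.ρ g s a)))
      (haarProbability G) := fun c s => by
    refine Continuous.integrable_of_hasCompactSupport ?_ (HasCompactSupport.of_compactSpace _)
    exact continuous_const.mul ((r.continuous.matrix_elem c b).mul
      (Complex.continuous_conj.comp (r.continuous.matrix_elem s a)))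
  have hcs : ∀ c s, ∫ g, X s c * (r.ρ g c b * (starRingEnd ℂ) (r.ρ g s a)) ∂haarProbability G =
      X s c * (if c = s ∧ b = a then ((r.N : ℂ))⁻¹ else 0) := fun c s => by
    rw [integral_const_mul, hr]
  rw [hexp, integral_finsetSum _ fun c _ => integrable_finsetSum _ fun s _ => hI c s]
  have hc : ∀ c, ∫ g, ∑ s, X s c * (r.ρ g c b * (starRingEnd ℂ) (r.ρ g s a)) ∂haarProbability G =
      ∑ s, X s c * (if c = s ∧ b = a then ((r.N : ℂ))⁻¹ else 0) := fun c => by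
    rw [integral_finsetSum _ fun s _ => hI c s]
    exact Finset.sum_congr rfl fun s _ => hcs c s
  simp_rw [hc]
  by_cases hab : a = b
  · subst hab
    rw [if_pos rfl, Matrix.trace, Finset.mul_sum]
    refine Finset.sum_congr rfl fun c _ => ?_
    rw [Finset.sum_eq_single_of_mem c (Finset.mem_univ c) fun s _ hs => by
      rw [if_neg (fun h => hs h.1.symm), mul_zero], if_pos ⟨rfl, rfl⟩, Matrix.diag_apply, mul_comm]
  · have hba : ¬ (b = a) := fun h => hab h.symm
    rw [if_neg hab]
    exact Finset.sum_eq_zero fun c _ => Finset.sum_eq_zero fun s _ => by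
      rw [if_neg (fun h => hba h.2), mul_zero]

-- The matrix-valued Bochner integrals below run in Mathlib's scoped Frobenius normed space; as in
-- `Mathlib/Analysis/Normed/Algebra/MatrixExponential.lean` and the tree's `LyapunovEquation.lean`,
-- this option bridges the reducibly-different topology instances of `Matrix n n ℂ`.
set_option backward.isDefEq.respectTransparency false in
omit [DecidableEq ι] in
/-- ★ **Schur averaging**: `∫ ρ(g⁻¹) X ρ(g) dg = (tr X / N) · 1`. [folklore] -/
theorem integral_conj_eq_smul_one (hr : HasSchurMoments r) (X : Matrix (Fin r.N) (Fin r.N) ℂ) :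
    ∫ g, r.ρ g⁻¹ * X * r.ρ g ∂haarProbability G =
      (((r.N : ℂ))⁻¹ * X.trace) • (1 : Matrix (Fin r.N) (Fin r.N) ℂ) := by
  have hF : Continuous fun g => r.ρ g⁻¹ * X * r.ρ g :=
    ((r.continuous.comp continuous_inv).mul continuous_const).mul r.continuous
  have hFi : Integrable (fun g => r.ρ g⁻¹ * X * r.ρ g) (haarProbability G) :=
    hF.integrable_of_hasCompactSupport (HasCompactSupport.of_compactSpace _)
  ext a b
  have h := ((Matrix.entryLinearMap ℝ ℂ a b).toContinuousLinearMap).integral_comp_comm hFi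
  simp only [LinearMap.coe_toContinuousLinearMap', Matrix.entryLinearMap_apply] at h
  rw [← h, integral_conj_apply hr X a b, Matrix.smul_apply, Matrix.one_apply, smul_eq_mul, mul_ite,
    mul_one, mul_zero]

omit [DecidableEq ι] [IsTopologicalGroup G] [MeasurableSpace G] [BorelSpace G] [Group G] [CompactSpace G] in
/-- An `ℝ`-linear functional that is constant along a continuous family takes that value at the
family's Haar average. [folklore] -/
theorem _root_.LinearMap.eq_apply_integral_of_forall_eq {V : Type*} [NormedAddCommGroup V]
    [NormedSpace ℝ V] [FiniteDimensional ℝ V] {Ω : Type*} [MeasurableSpace Ω] (ν : Measure Ω)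
    [IsProbabilityMeasure ν] (Ψ : V →ₗ[ℝ] ℝ) {F : Ω → V} (hF : Integrable F ν) {X : V}
    (h : ∀ g, Ψ (F g) = Ψ X) : Ψ X = Ψ (∫ g, F g ∂ν) := by
  have h1 := (LinearMap.toContinuousLinearMap Ψ).integral_comp_comm hF
  simp only [LinearMap.coe_toContinuousLinearMap', h, integral_const, probReal_univ, one_smul] at h1
  exact h1

end Averaging

/-! ## The vanishing theorem -/

section Main

variable [IsTopologicalGroup G] [CompactSpace G] [MeasurableSpace G] [BorelSpace G]
  [SecondCountableTopology G] [Countable ι] {r} {e : ι}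

omit [DecidableEq ι] [CompactSpace G] [SecondCountableTopology G] [Countable ι] in
/-- Global conjugation is measurable. -/
theorem measurable_conjAct (g : G) : Measurable (conjAct (ι := ι) g) :=
  measurable_pi_iff.mpr fun i =>
    show Measurable (fun U : ι → G => g * U i * g⁻¹) from
      ((measurable_pi_apply i : Measurable fun U : ι → G => U i).const_mul g).mul_const g⁻¹

omit [DecidableEq ι] [Group G] [IsTopologicalGroup G] in
/-- Continuous functions on the (compact) configuration space are integrable for a finite measure. -/
theorem integrable_of_continuous_config (μ : Measure (ι → G)) [IsFiniteMeasure μ] {F : (ι → G) → ℝ}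
    (hF : Continuous F) : Integrable F μ := by
  obtain ⟨C, hC⟩ := isCompact_univ.exists_bound_of_continuousOn hF.continuousOn
  exact Integrable.of_bound hF.aestronglyMeasurable C (ae_of_all _ fun x => hC x (Set.mem_univ x))

set_option backward.isDefEq.respectTransparency false in
/-- ★★ **MAIN: the right-hand side of a conjugation-invariant Schwinger–Dyson row vanishes.** Let
`ρ` have the Schur second moments, `μ` be a finite measure on `ι → G` invariant under global
conjugation, `f` continuous and conjugation invariant, `S` conjugation invariant with a linear
one-link shift derivative `D` at `e`, and `X` a TRACELESS generator (`ρ(k t) = e^{tX}`). Then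
`∫ f · (X·S) dμ = ∫ f(U) D U X dμ = 0`. Proof: `Ψ(Y) = ∫ f · D(·) Y dμ` is `ℝ`-linear and, by
covariance and invariance, `Ψ(ρ(g⁻¹) X ρ(g)) = Ψ(X)` for all `g`; averaging over `g` (Schur),
`Ψ(X) = Ψ((tr X / N) · 1) = Ψ(0) = 0`. [folklore] -/
theorem integral_mul_linearShiftDeriv_eq_zero (hr : HasSchurMoments r) {μ : Measure (ι → G)}
    [IsFiniteMeasure μ] (hμ : ∀ g : G, μ.map (conjAct g) = μ) {S : (ι → G) → ℝ}
    {D : (ι → G) → Matrix (Fin r.N) (Fin r.N) ℂ →ₗ[ℝ] ℝ} (hD : HasLinearShiftDeriv r e S D)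
    (hS : ∀ g U, S (conjAct g U) = S U) {f : (ι → G) → ℝ} (hf : Continuous f)
    (hfi : ∀ g U, f (conjAct g U) = f U) {k : ℝ → G} {X : Matrix (Fin r.N) (Fin r.N) ℂ}
    (hX : ∀ t, r.ρ (k t) = exp ((t : ℂ) • X)) (htr : X.trace = 0) :
    ∫ U, f U * D U X ∂μ = 0 := by
  have hint : ∀ Y, Integrable (fun U => f U * D U Y) μ := fun Y =>
    integrable_of_continuous_config μ (hf.mul (hD.1 Y))
  let Ψ : Matrix (Fin r.N) (Fin r.N) ℂ →ₗ[ℝ] ℝ :=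
    { toFun := fun Y => ∫ U, f U * D U Y ∂μ
      map_add' := fun Y Z => by
        simp only [map_add, mul_add]
        exact integral_add (hint Y) (hint Z)
      map_smul' := fun c Y => by
        simp only [map_smul, smul_eq_mul, RingHom.id_apply]
        rw [← integral_const_mul]
        congr 1
        funext U
        ring }
  have hΨ : ∀ g : G, Ψ (r.ρ g⁻¹ * X * r.ρ g) = Ψ X := by
    intro g
    change ∫ U, f U * D U (r.ρ g⁻¹ * X * r.ρ g) ∂μ = ∫ U, f U * D U X ∂μ
    have h1 : (fun U => f U * D U (r.ρ g⁻¹ * X * r.ρ g)) =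
        fun U => f (conjAct g U) * D (conjAct g U) X := by
      funext U
      rw [hfi, hD.apply_conjAct hS hX]
    rw [h1]
    have h2 := integral_map (μ := μ) (measurable_conjAct g).aemeasurable
      (f := fun U => f U * D U X) ((hf.mul (hD.1 X)).aestronglyMeasurable)
    rw [hμ g] at h2
    exact h2.symm
  have hF : Continuous fun g : G => r.ρ g⁻¹ * X * r.ρ g :=
    ((r.continuous.comp continuous_inv).mul continuous_const).mul r.continuous
  have hmain := Ψ.eq_apply_integral_of_forall_eq (haarProbability G)
    (hF.integrable_of_hasCompactSupport (HasCompactSupport.of_compactSpace _)) hΨ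
  rw [integral_conj_eq_smul_one hr, htr, mul_zero, zero_smul, map_zero] at hmain
  exact hmain

/-- ★★ The same with ANY derivative `S'` of `S` along the shift (uniqueness of derivatives):
`∫ f · S' dμ = 0`. [folklore] -/
theorem integral_mul_shiftDeriv_eq_zero (hr : HasSchurMoments r) {μ : Measure (ι → G)}
    [IsFiniteMeasure μ] (hμ : ∀ g : G, μ.map (conjAct g) = μ) {S : (ι → G) → ℝ}
    {D : (ι → G) → Matrix (Fin r.N) (Fin r.N) ℂ →ₗ[ℝ] ℝ} (hD : HasLinearShiftDeriv r e S D)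
    (hS : ∀ g U, S (conjAct g U) = S U) {f : (ι → G) → ℝ} (hf : Continuous f)
    (hfi : ∀ g U, f (conjAct g U) = f U) {k : ℝ → G} {X : Matrix (Fin r.N) (Fin r.N) ℂ}
    (hX : ∀ t, r.ρ (k t) = exp ((t : ℂ) • X)) (htr : X.trace = 0) {S' : (ι → G) → ℝ}
    (hS' : ∀ U, HasDerivAt (fun t => S (Function.update U e (k t * U e))) (S' U) 0) :
    ∫ U, f U * S' U ∂μ = 0 := by
  have h : S' = fun U => D U X := funext fun U => hD.eq_of_hasDerivAt hX (hS' U)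
  rw [h]
  exact integral_mul_linearShiftDeriv_eq_zero hr hμ hD hS hf hfi hX htr

/-- ★★ **The left-hand side vanishes too**: for a conjugation-invariant `f` with a linear shift
derivative (e.g. a conjugation-invariant polynomial observable) and a traceless generator,
`∫ X·f dμ = 0` for every conjugation-invariant finite `μ`. [folklore] -/
theorem integral_shiftDeriv_eq_zero (hr : HasSchurMoments r) {μ : Measure (ι → G)}
    [IsFiniteMeasure μ] (hμ : ∀ g : G, μ.map (conjAct g) = μ) {f : (ι → G) → ℝ}
    {D : (ι → G) → Matrix (Fin r.N) (Fin r.N) ℂ →ₗ[ℝ] ℝ} (hD : HasLinearShiftDeriv r e f D)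
    (hfi : ∀ g U, f (conjAct g U) = f U) {k : ℝ → G} {X : Matrix (Fin r.N) (Fin r.N) ℂ}
    (hX : ∀ t, r.ρ (k t) = exp ((t : ℂ) • X)) (htr : X.trace = 0) {f' : (ι → G) → ℝ}
    (hf' : ∀ U, HasDerivAt (fun t => f (Function.update U e (k t * U e))) (f' U) 0) :
    ∫ U, f' U ∂μ = 0 := by
  have h := integral_mul_shiftDeriv_eq_zero hr hμ hD hfi continuous_const (fun _ _ => rfl) hX htr hf'
    (f := fun _ => (1 : ℝ))
  simpa using h

/-- ★★ **A conjugation-invariant Schwinger–Dyson row is `0 = β · 0`**: for `μ`, `f`, `S` invariant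
under global conjugation (`f`, `S` with linear shift derivatives — e.g. polynomial observables —
and `f` continuous) and a traceless generator `X`, the row `∫ X·f dμ = β ∫ f · (X·S) dμ` holds at
EVERY real `β`. [folklore] -/
theorem sdRow_of_conjInvariant (hr : HasSchurMoments r) {μ : Measure (ι → G)} [IsFiniteMeasure μ]
    (hμ : ∀ g : G, μ.map (conjAct g) = μ) {f S : (ι → G) → ℝ}
    {Df DS : (ι → G) → Matrix (Fin r.N) (Fin r.N) ℂ →ₗ[ℝ] ℝ} (hDf : HasLinearShiftDeriv r e f Df)
    (hDS : HasLinearShiftDeriv r e S DS) (hf : Continuous f) (hfi : ∀ g U, f (conjAct g U) = f U)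
    (hS : ∀ g U, S (conjAct g U) = S U) {k : ℝ → G} {X : Matrix (Fin r.N) (Fin r.N) ℂ}
    (hX : ∀ t, r.ρ (k t) = exp ((t : ℂ) • X)) (htr : X.trace = 0) {f' S' : (ι → G) → ℝ}
    (hf' : ∀ U, HasDerivAt (fun t => f (Function.update U e (k t * U e))) (f' U) 0)
    (hS' : ∀ U, HasDerivAt (fun t => S (Function.update U e (k t * U e))) (S' U) 0) (β : ℝ) :
    ∫ U, f' U ∂μ = β * ∫ U, f U * S' U ∂μ := by
  rw [integral_shiftDeriv_eq_zero hr hμ hDf hfi hX htr hf',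
    integral_mul_shiftDeriv_eq_zero hr hμ hDS hS hf hfi hX htr hS', mul_zero]

end Main

/-! ## Appendix: a conjugation-invariant row sees only the central component of its generator -/

section Central

variable [IsTopologicalGroup G] [CompactSpace G] [MeasurableSpace G] [BorelSpace G]
  [SecondCountableTopology G] [Countable ι] {r} {e : ι}

set_option backward.isDefEq.respectTransparency false in
/-- ★★ **Without the trace condition**: for `μ`, `f`, `S` invariant under global conjugation as in
`integral_mul_linearShiftDeriv_eq_zero` and ANY generator `X` of a one-parameter family,
`∫ f(U) · D U X dμ = ∫ f(U) · D U ((tr X / N) · 1) dμ` — a conjugation-invariant row sees only the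
CENTRAL component `(tr X / N) · 1` of its generator (for `U(N)` along `e^{tX}`, `X ∈ 𝔲(N)`: the
`U(1)` direction `i · 1`; for traceless `X` this is `integral_mul_linearShiftDeriv_eq_zero`).
[folklore] -/
theorem integral_mul_linearShiftDeriv_eq_central (hr : HasSchurMoments r) {μ : Measure (ι → G)}
    [IsFiniteMeasure μ] (hμ : ∀ g : G, μ.map (conjAct g) = μ) {S : (ι → G) → ℝ}
    {D : (ι → G) → Matrix (Fin r.N) (Fin r.N) ℂ →ₗ[ℝ] ℝ} (hD : HasLinearShiftDeriv r e S D)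
    (hS : ∀ g U, S (conjAct g U) = S U) {f : (ι → G) → ℝ} (hf : Continuous f)
    (hfi : ∀ g U, f (conjAct g U) = f U) {k : ℝ → G} {X : Matrix (Fin r.N) (Fin r.N) ℂ}
    (hX : ∀ t, r.ρ (k t) = exp ((t : ℂ) • X)) :
    ∫ U, f U * D U X ∂μ =
      ∫ U, f U * D U ((((r.N : ℂ))⁻¹ * X.trace) • (1 : Matrix (Fin r.N) (Fin r.N) ℂ)) ∂μ := by
  have hint : ∀ Y, Integrable (fun U => f U * D U Y) μ := fun Y =>
    integrable_of_continuous_config μ (hf.mul (hD.1 Y))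
  let Ψ : Matrix (Fin r.N) (Fin r.N) ℂ →ₗ[ℝ] ℝ :=
    { toFun := fun Y => ∫ U, f U * D U Y ∂μ
      map_add' := fun Y Z => by
        simp only [map_add, mul_add]
        exact integral_add (hint Y) (hint Z)
      map_smul' := fun c Y => by
        simp only [map_smul, smul_eq_mul, RingHom.id_apply]
        rw [← integral_const_mul]
        congr 1
        funext U
        ring }
  have hΨ : ∀ g : G, Ψ (r.ρ g⁻¹ * X * r.ρ g) = Ψ X := by
    intro g
    change ∫ U, f U * D U (r.ρ g⁻¹ * X * r.ρ g) ∂μ = ∫ U, f U * D U X ∂μ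
    have h1 : (fun U => f U * D U (r.ρ g⁻¹ * X * r.ρ g)) =
        fun U => f (conjAct g U) * D (conjAct g U) X := by
      funext U
      rw [hfi, hD.apply_conjAct hS hX]
    rw [h1]
    have h2 := integral_map (μ := μ) (measurable_conjAct g).aemeasurable
      (f := fun U => f U * D U X) ((hf.mul (hD.1 X)).aestronglyMeasurable)
    rw [hμ g] at h2
    exact h2.symm
  have hF : Continuous fun g : G => r.ρ g⁻¹ * X * r.ρ g :=
    ((r.continuous.comp continuous_inv).mul continuous_const).mul r.continuous
  have hmain := Ψ.eq_apply_integral_of_forall_eq (haarProbability G)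
    (hF.integrable_of_hasCompactSupport (HasCompactSupport.of_compactSpace _)) hΨ
  rw [integral_conj_eq_smul_one hr] at hmain
  exact hmain

end Central

end Summit.QuantumFields.GaugeBoot

end
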